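import Summits.Ventures.HodgeRepro2.T5SU11LegendreExpansion
import Mathlib.Topology.ContinuousMap.Weierstrass

/-!
# The Legendre series of a continuous function: best `L²`-approximation, Bessel's inequality, and `L²`-convergence
(completeness of the Legendre polynomials on `C[−1, 1]`)

For `f` continuous on `[−1, 1]` let `c_k(f) := ((2k + 1)/2) ∫_{−1}^{1} f P_k` (`fourierLegendre`) and
`S_d f := Σ_{k ≤ d} c_k(f) P_k` (`partialSum`, the `d`-th partial Legendre series). Orthogonality (row 383) gives
`∫ (f − S_d f) · q = 0` for every polynomial `q` of degree `≤ d` (`integral_sub_partialSum_mul_eq_zero`, via row 406's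
span of `P_0, …, P_d`), hence PYTHAGORAS

  **`∫ (f − p)² = ∫ (f − S_d f)² + ∫ (S_d f − p)²` for every polynomial `p` of degree `≤ d`**   (`integral_sub_sq_eq`),

so `S_d f` is the best `L²`-approximation of `f` among the polynomials of degree `≤ d` (`integral_sub_partialSum_sq_le`),
BESSEL'S INEQUALITY `Σ_{k ≤ d} 2 c_k(f)²/(2k + 1) ≤ ∫ f²` holds (`bessel`), and with Weierstrass' theorem
(Mathlib's `exists_polynomial_near_of_continuousOn`)

  **`∫_{−1}^{1} (f − S_d f)² → 0` as `d → ∞`**   (`tendsto_integral_sub_partialSum_sq`),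
  **`Σ_{k ≤ d} 2 c_k(f)²/(2k + 1) → ∫_{−1}^{1} f²`** — PARSEVAL for continuous functions   (`tendsto_sum_sq`):

the Legendre polynomials are complete in `L²[−1, 1]` on the continuous functions. Nothing is claimed about (N).

Blind lane: Mathlib + the HodgeRepro2 prefix only; no sorry; axioms ⊆ {propext, Classical.choice,
Quot.sound}.
-/

namespace Summit.Ventures.HodgeRepro2.T5SU11LegendreSeries

open Polynomial intervalIntegral Finset Set Filter Topology
open T5SU11SphericalLegendreAll T5SU11JacobiPhaseLawEven T5SU11JacobiLegendreLeading T5SU11LegendreIdentities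
  T5SU11LegendreOrthogonal T5SU11LegendreOrthogonalLower T5SU11LegendreExpansion

/-! ### The Fourier–Legendre coefficients and the partial sums of a function -/

/-- **The Fourier–Legendre coefficient of a function** `c_k(f) = ((2k + 1)/2) ∫_{−1}^{1} f(x) P_k(x) dx`. -/
noncomputable def fourierLegendre (f : ℝ → ℝ) (k : ℕ) : ℝ :=
  (2 * (k : ℝ) + 1) / 2 * ∫ x in (-1 : ℝ)..1, f x * legP k x

/-- **The `d`-th partial Legendre series** `S_d f(x) = Σ_{k ≤ d} c_k(f) P_k(x)`. -/
noncomputable def partialSum (f : ℝ → ℝ) (d : ℕ) (x : ℝ) : ℝ :=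
  ∑ k ∈ range (d + 1), fourierLegendre f k * legP k x

/-- `S_d f` is the evaluation of the polynomial `Σ_{k ≤ d} C(c_k(f)) · legPoly k`. -/
theorem partialSum_eq_eval (f : ℝ → ℝ) (d : ℕ) (x : ℝ) :
    partialSum f d x = (∑ k ∈ range (d + 1), C (fourierLegendre f k) * legPoly k).eval x := by
  rw [partialSum, eval_finsetSum]
  exact Finset.sum_congr rfl fun k _ => by rw [eval_mul, eval_C, ← legP_eq_eval]

/-- `S_d f` is continuous. -/
theorem continuous_partialSum (f : ℝ → ℝ) (d : ℕ) : Continuous (partialSum f d) := by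
  have : partialSum f d = fun x => (∑ k ∈ range (d + 1), C (fourierLegendre f k) * legPoly k).eval x :=
    funext fun x => partialSum_eq_eval f d x
  rw [this]
  exact Polynomial.continuous _

/-- `natDegree (Σ_{k ≤ d} C(c_k) legPoly k) ≤ d`. -/
theorem natDegree_partialSum_poly_le (c : ℕ → ℝ) (d : ℕ) :
    (∑ k ∈ range (d + 1), C (c k) * legPoly k).natDegree ≤ d := by
  refine natDegree_sum_le_of_forall_le _ _ fun k hk => ?_
  calc (C (c k) * legPoly k).natDegree ≤ (legPoly k).natDegree := natDegree_C_mul_le _ _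
    _ = k := natDegree_legPoly k
    _ ≤ d := Nat.lt_succ_iff.mp (Finset.mem_range.mp hk)

section continuous

variable {f : ℝ → ℝ} (hf : ContinuousOn f (Icc (-1 : ℝ) 1))
include hf

/-- Interval integrability of `f · g` for continuous `g`. -/
theorem intervalIntegrable_mul_continuous {g : ℝ → ℝ} (hg : Continuous g) :
    IntervalIntegrable (fun x => f x * g x) MeasureTheory.volume (-1 : ℝ) 1 :=
  (hf.mul hg.continuousOn).intervalIntegrable_of_Icc (by norm_num)

omit hf in
/-- `∫ S_d f · P_k = ∫ f · P_k` for `k ≤ d` (the orthogonality of row 383). -/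
theorem integral_partialSum_mul_legP {d k : ℕ} (hk : k ≤ d) :
    ∫ x in (-1 : ℝ)..1, partialSum f d x * legP k x = ∫ x in (-1 : ℝ)..1, f x * legP k x := by
  simp_rw [partialSum_eq_eval]
  rw [integral_sum_mul_legP (fourierLegendre f) hk, fourierLegendre]
  have : (2 * (k : ℝ) + 1) ≠ 0 := by positivity
  field_simp

/-- **`∫ (f − S_d f) · P_k = 0` for `k ≤ d`.** -/
theorem integral_sub_partialSum_mul_legP {d k : ℕ} (hk : k ≤ d) :
    ∫ x in (-1 : ℝ)..1, (f x - partialSum f d x) * legP k x = 0 := by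
  simp_rw [sub_mul]
  have i1 : IntervalIntegrable (fun x => f x * legP k x) MeasureTheory.volume (-1 : ℝ) 1 :=
    intervalIntegrable_mul_continuous hf (continuous_legP k)
  have i2 : IntervalIntegrable (fun x => partialSum f d x * legP k x) MeasureTheory.volume (-1 : ℝ) 1 :=
    ((continuous_partialSum f d).mul (continuous_legP k)).intervalIntegrable _ _
  rw [integral_sub i1 i2, integral_partialSum_mul_legP hk, sub_self]

/-- **`∫ (f − S_d f) · q = 0` for every polynomial `q` of degree `≤ d`** (row 406's span). -/
theorem integral_sub_partialSum_mul_eq_zero {d : ℕ} {q : ℝ[X]} (hq : q.natDegree ≤ d) :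
    ∫ x in (-1 : ℝ)..1, (f x - partialSum f d x) * q.eval x = 0 := by
  obtain ⟨c, hc⟩ := exists_eq_sum_C_mul_legPoly d q hq
  rw [hc]
  simp_rw [eval_finsetSum, eval_mul, eval_C, ← legP_eq_eval, Finset.mul_sum]
  have hint : ∀ k ∈ range (d + 1), IntervalIntegrable (fun x => (f x - partialSum f d x) * (c k * legP k x))
      MeasureTheory.volume (-1 : ℝ) 1 := fun k _ =>
    ((hf.sub (continuous_partialSum f d).continuousOn).mul (continuous_const.mul (continuous_legP k)).continuousOn)
      |>.intervalIntegrable_of_Icc (by norm_num)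
  rw [integral_finsetSum hint]
  refine Finset.sum_eq_zero fun k hk => ?_
  have e : ∀ x, (f x - partialSum f d x) * (c k * legP k x) = c k * ((f x - partialSum f d x) * legP k x) :=
    fun x => by ring
  simp_rw [e]
  rw [integral_const_mul, integral_sub_partialSum_mul_legP hf (Nat.lt_succ_iff.mp (Finset.mem_range.mp hk)),
    mul_zero]

/-! ### Pythagoras, the best approximation and Bessel -/

/-- **PYTHAGORAS**: `∫ (f − p)² = ∫ (f − S_d f)² + ∫ (S_d f − p)²` for every polynomial `p` of degree `≤ d`. -/
theorem integral_sub_sq_eq {d : ℕ} {p : ℝ[X]} (hp : p.natDegree ≤ d) :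
    ∫ x in (-1 : ℝ)..1, (f x - p.eval x) ^ 2
      = (∫ x in (-1 : ℝ)..1, (f x - partialSum f d x) ^ 2)
        + ∫ x in (-1 : ℝ)..1, (partialSum f d x - p.eval x) ^ 2 := by
  -- the cross term `2 ∫ (f − S_d f)(S_d f − p)` vanishes: `S_d f − p` is a polynomial of degree `≤ d`
  set q : ℝ[X] := (∑ k ∈ range (d + 1), C (fourierLegendre f k) * legPoly k) - p with hq
  have hqdeg : q.natDegree ≤ d :=
    (natDegree_sub_le _ _).trans (max_le (natDegree_partialSum_poly_le _ d) hp)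
  have hqev : ∀ x, q.eval x = partialSum f d x - p.eval x := fun x => by
    rw [hq, eval_sub, partialSum_eq_eval]
  have hcross := integral_sub_partialSum_mul_eq_zero hf hqdeg
  simp_rw [hqev] at hcross
  have e : ∀ x, (f x - p.eval x) ^ 2
      = (f x - partialSum f d x) ^ 2 + (partialSum f d x - p.eval x) ^ 2
        + 2 * ((f x - partialSum f d x) * (partialSum f d x - p.eval x)) := fun x => by ring
  simp_rw [e]
  have hS := continuous_partialSum f d
  have i1 : IntervalIntegrable (fun x => (f x - partialSum f d x) ^ 2) MeasureTheory.volume (-1 : ℝ) 1 :=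
    ((hf.sub hS.continuousOn).pow 2).intervalIntegrable_of_Icc (by norm_num)
  have i2 : IntervalIntegrable (fun x => (partialSum f d x - p.eval x) ^ 2) MeasureTheory.volume (-1 : ℝ) 1 :=
    ((hS.sub p.continuous).pow 2).intervalIntegrable _ _
  have i3 : IntervalIntegrable (fun x => 2 * ((f x - partialSum f d x) * (partialSum f d x - p.eval x)))
      MeasureTheory.volume (-1 : ℝ) 1 :=
    (continuous_const.continuousOn.mul ((hf.sub hS.continuousOn).mul (hS.sub p.continuous).continuousOn))
      |>.intervalIntegrable_of_Icc (by norm_num)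
  rw [integral_add (i1.add i2) i3, integral_add i1 i2, integral_const_mul, hcross, mul_zero, add_zero]

/-- **`S_d f` is the best `L²`-approximation of `f` by polynomials of degree `≤ d`.** -/
theorem integral_sub_partialSum_sq_le {d : ℕ} {p : ℝ[X]} (hp : p.natDegree ≤ d) :
    ∫ x in (-1 : ℝ)..1, (f x - partialSum f d x) ^ 2 ≤ ∫ x in (-1 : ℝ)..1, (f x - p.eval x) ^ 2 := by
  rw [integral_sub_sq_eq hf hp]
  have : 0 ≤ ∫ x in (-1 : ℝ)..1, (partialSum f d x - p.eval x) ^ 2 :=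
    integral_nonneg (by norm_num) fun x _ => sq_nonneg _
  linarith

omit hf in
/-- `∫ (S_d f)² = Σ_{k ≤ d} 2 c_k(f)²/(2k + 1)` (row 409's Parseval for the polynomial `S_d f`). -/
theorem integral_partialSum_sq (d : ℕ) :
    ∫ x in (-1 : ℝ)..1, partialSum f d x ^ 2
      = ∑ k ∈ range (d + 1), fourierLegendre f k ^ 2 * (2 / (2 * (k : ℝ) + 1)) := by
  simp_rw [partialSum_eq_eval]
  rw [integral_sq_eq_sum (natDegree_partialSum_poly_le _ d)]
  refine Finset.sum_congr rfl fun k hk => ?_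
  rw [← coeff_eq_legendreCoeff rfl (Nat.lt_succ_iff.mp (Finset.mem_range.mp hk))]

/-- **BESSEL'S INEQUALITY**: `Σ_{k ≤ d} 2 c_k(f)²/(2k + 1) ≤ ∫_{−1}^{1} f²`. -/
theorem bessel (d : ℕ) :
    ∑ k ∈ range (d + 1), fourierLegendre f k ^ 2 * (2 / (2 * (k : ℝ) + 1)) ≤ ∫ x in (-1 : ℝ)..1, f x ^ 2 := by
  have h := integral_sub_sq_eq hf (d := d) (p := 0) (by simp)
  simp only [eval_zero, sub_zero] at h
  rw [← integral_partialSum_sq d, h]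
  have : 0 ≤ ∫ x in (-1 : ℝ)..1, (f x - partialSum f d x) ^ 2 :=
    integral_nonneg (by norm_num) fun x _ => sq_nonneg _
  linarith

/-! ### `L²`-convergence and Parseval -/

/-- **The Legendre series converges in `L²`**: `∫_{−1}^{1} (f − S_d f)² → 0` (Weierstrass + best approximation). -/
theorem tendsto_integral_sub_partialSum_sq :
    Tendsto (fun d => ∫ x in (-1 : ℝ)..1, (f x - partialSum f d x) ^ 2) atTop (𝓝 0) := by
  rw [Metric.tendsto_atTop]
  intro ε hε
  -- a polynomial within `√(ε/4)` of `f`: then `∫ (f − p)² ≤ 2 · ε/4 < ε`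
  obtain ⟨p, hp⟩ := exists_polynomial_near_of_continuousOn (-1) 1 f hf (Real.sqrt (ε / 4))
    (Real.sqrt_pos.mpr (by positivity))
  refine ⟨p.natDegree, fun d hd => ?_⟩
  rw [Real.dist_eq, sub_zero, abs_of_nonneg (integral_nonneg (by norm_num) fun x _ => sq_nonneg _)]
  refine lt_of_le_of_lt (integral_sub_partialSum_sq_le hf hd) ?_
  have hbound : ∀ x ∈ Set.uIoc (-1 : ℝ) 1, ‖(f x - p.eval x) ^ 2‖ ≤ ε / 4 := fun x hx => by
    have hx' : x ∈ Icc (-1 : ℝ) 1 := by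
      rw [uIoc_of_le (by norm_num)] at hx
      exact Ioc_subset_Icc_self hx
    rw [Real.norm_eq_abs, abs_of_nonneg (sq_nonneg _), ← sq_abs, abs_sub_comm]
    have h1 := (hp x hx').le
    have h2 : 0 ≤ |p.eval x - f x| := abs_nonneg _
    calc |p.eval x - f x| ^ 2 ≤ Real.sqrt (ε / 4) ^ 2 := pow_le_pow_left₀ h2 h1 2
      _ = ε / 4 := Real.sq_sqrt (by positivity)
  have := norm_integral_le_of_norm_le_const hbound
  rw [Real.norm_eq_abs, abs_of_nonneg (integral_nonneg (by norm_num) fun x _ => sq_nonneg _)] at this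
  norm_num at this
  linarith

/-- **PARSEVAL for continuous functions**: `Σ_{k ≤ d} 2 c_k(f)²/(2k + 1) → ∫_{−1}^{1} f²`. -/
theorem tendsto_sum_sq :
    Tendsto (fun d => ∑ k ∈ range (d + 1), fourierLegendre f k ^ 2 * (2 / (2 * (k : ℝ) + 1))) atTop
      (𝓝 (∫ x in (-1 : ℝ)..1, f x ^ 2)) := by
  have h := tendsto_integral_sub_partialSum_sq hf
  have e : ∀ d, ∑ k ∈ range (d + 1), fourierLegendre f k ^ 2 * (2 / (2 * (k : ℝ) + 1))
      = (∫ x in (-1 : ℝ)..1, f x ^ 2) - ∫ x in (-1 : ℝ)..1, (f x - partialSum f d x) ^ 2 := fun d => by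
    have hP := integral_sub_sq_eq hf (d := d) (p := 0) (by simp)
    simp only [eval_zero, sub_zero] at hP
    rw [← integral_partialSum_sq d, hP]
    ring
  simp_rw [e]
  have := (tendsto_const_nhds (x := ∫ x in (-1 : ℝ)..1, f x ^ 2)).sub h
  simpa using this

/-- **The Legendre polynomials are complete on `C[−1, 1]`**: a continuous `f` with all Fourier–Legendre coefficients
zero has `∫ f² = 0`. -/
theorem integral_sq_eq_zero_of_fourierLegendre_eq_zero (h0 : ∀ k, fourierLegendre f k = 0) :
    ∫ x in (-1 : ℝ)..1, f x ^ 2 = 0 := by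
  have h := tendsto_sum_sq hf
  simp only [h0, zero_pow two_ne_zero, zero_mul, Finset.sum_const_zero] at h
  exact (tendsto_nhds_unique tendsto_const_nhds h).symm

end continuous

end Summit.Ventures.HodgeRepro2.T5SU11LegendreSeries
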